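import Literature.Analysis.FluidPDE.Tao2016AveragedNS.TriggerTolerance
import Literature.Analysis.FluidPDE.FluidComputer.LocalCircuit
import HarnessLib

/-!
# Tao 2016, §5.5 ↔ the cell's local circuit design: the delay circuit CERTIFIED as a gate

T. Tao, *Finite time blowup for an averaged three-dimensional Navier–Stokes equation*, J. Amer.
Math. Soc. **29** (2016) 601–674 = arXiv:1402.0290: §5.5, the delay circuit (5.5)–(5.6) and
Theorem 5.3 (pp. 28–30 of the arXiv version); §1.3 pp. 10–11 (the machine paradigm).
[`Tao2016AveragedNS`]

HONEST FRAMING (cell pub-fluidc): low prior, high value-of-information experiment on Tao's machine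
paradigm; NOT a claim that NS blows up. This file proves theorems about the five-dimensional ODE
(5.5) and records, as a TYPE, which fields of the cell's circuit design they do and do not supply;
it constructs nothing for the Navier–Stokes equations (true or averaged).

## What the file does

The cell's `FluidComputer/LocalCircuit.lean` types Tao's machine at the local layer as a structure
`LocalCircuit S O s` whose fields fall into two groups:
(A) finite-dimensional ODE data — the REGIONS `Ain ⊇ ball(Acore, δ)`, `Aout`, the design vector
    field `F`, `L`-Lipschitz on an open working region `U`, its flow `Φ` over rescaled time
    `[0, τc]`, the admissible defect `ε`, the tube radius `δsh` with the DEFECT BUDGET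
    `gronwallBound 0 L ε τc ≤ δsh`, the TUBE condition and the delayed abrupt transition with
    margin `dat` ("ONE finite-dimensional validated computation" for a concrete design);
(B) everything that talks to the fluid — READOUT / reconstruction / junk and their moduli, the junk
    thresholds, STATICS (`handoff`, `floor_cert`), the leak budget, the CLOCK, the two GUARDED
    a-priori inequalities `defect` / `junk_rate` about every `H¹⁰_df`-mild Navier–Stokes
    trajectory, and the SEED.
This file makes the split a type and inhabits group (A) by Tao's own gate:
* §1 `GateCertificate O` = group (A) verbatim; `GatePhysics S O s c` = group (B) verbatim over a
  certificate `c`; `GateCertificate.localCircuit : (c : GateCertificate O) → GatePhysics S O s c →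
  LocalCircuit S O s` and the projections `LocalCircuit.gateCertificate` / `LocalCircuit.gatePhysics`,
  a definitional isomorphism (`LocalCircuit.localCircuit_gateCertificate … = A` by `rfl`).
* §2 the global flow `delayFlow K ε : ℝ → ℝ⁵ → ℝ⁵` of (5.5) (global well-posedness by energy
  conservation, `GlobalWellposedness.lean`; chosen by `Classical.choice` and identified with every
  solution by uniqueness, `delayFlow_eq_of_hasDerivAt`; through (5.6) it is `delaySolution K ε` of
  `DelayCircuitHolds.lean`, `delayFlow_delayInit`), with `‖delayFlow K ε σ p‖_∞ ≤ √(energy p)`.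
* §3 KICK + DEFECT AT ONCE: `IsPseudoOrbit.fires_near` — a `δ`-pseudo-orbit of (5.5) issued
  `δ₀`-close to ANY firing trajectory `X` in the unit sup-ball (`HasAbruptTransition C K X`) fires
  with efficiency loss `θ` under the Grönwall budget `(δ₀ + δT)e^{LT} ≤ θ` (the fundamental lemma,
  `CircuitShadowing.lean`, whose `fires_of_budget` had `X` = the trajectory of (5.6) only); and
  `kicked_pseudoOrbit_fires` — the same from every kicked datum `kickInit κ`,
  `0 ≤ κ ≤ kickTolerance K ε` (`TriggerTolerance.kick_hasAbruptTransition`), i.e. the trigger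
  channel's one-sided tolerance and the generic defect channel combined, constants `C = 200`,
  `K ≥ K₀ = 8¹¹¹·111! + 2·20⁴²·42! + 16`, `0 < ε ≤ ε₁(K) = e^{-10K¹⁰}/K¹⁰⁰` of the tree's proof of
  Theorem 5.3.
* §4–§5 THE CERTIFICATE `taoGate (h : GateBudget K ε ρ εd θ) : GateCertificate (Fin 5 → ℝ)`
  (sup norm; `X 0 = a` input, `X 2 = c` trigger, `X 4 = ã` output) with
  `Ain = trigIn K ε ρ` := the `ρ`-neighbourhood of the SEGMENT `{kickInit κ : 0 ≤ κ ≤ kickTolerance K ε}`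
  of admissible trigger pre-loads through (5.6), `Acore = trigIn K ε (ρ/2)`, `δ = ρ/2`;
  `Aout = firedOut 200 K θ := {ã ≥ 1 - 200K⁻¹⁰ - θ, |other modes| ≤ 200K⁻¹⁰ + θ}`;
  `F = delayCircuit K ε`, `U` = the open sup-ball of radius `2`,
  `L = delayLipschitz K ε 2 = 8(ε + ε²e^{-K¹⁰} + K¹⁰/ε + 1/ε² + K)`, `Φ = delayFlow K ε`, `τc = 2`,
  defect `ε = εd`, tube radius `δsh = θ - ρe^{2L}`. The standing hypotheses `GateBudget K ε ρ εd θ`: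
  `K ≥ K₀`, `0 < ε ≤ ε₁(K)`, `ρ > 0`, `εd ≥ 0`, `θ ≤ 1/4` and the GRÖNWALL BUDGET
  `(ρ + 2εd)e^{2L} ≤ θ`, i.e. `ρ + 2εd ≤ shadowRadius K ε 2 2 θ` (`GateBudget.of_le_shadowRadius`;
  budgets exist for every admissible `K, ε` and `0 < θ ≤ 1/4`, `GateBudget.exists_of`). Field by
  field: `F_lip` = `lipschitzOnWith_delayCircuit`; `flow_*` = §2; `δsh_ge` = the cell's own
  `gronwallBound_le_of_budget` from `2εd e^{2L} ≤ θ - ρe^{2L}`; `tube`: on `trigIn K ε ρ`, `ρ ≤ 1/4`,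
  the energy is `≤ 2 + 10ρ² ≤ (17/10)²`, so flow lines stay in the sup-ball of radius `17/10` and
  their `δsh ≤ θ ≤ 1/4`-thickening in the open ball of radius `2`; `dat`: for `p` within `ρ` of
  `kickInit κ`, Theorem 5.3 for the kicked datum gives the fired window from `σ = t_c + K^{-1/2}`
  (`∈ [0,2]` as `K ≥ K₀`), Grönwall between the two EXACT trajectories puts `delayFlow K ε σ p`
  within `ρe^{Lσ} ≤ ρe^{2L}` of it, and the closed `δsh`-ball around that point is within `θ` of the
  kicked trajectory, hence inside `firedOut 200 K θ`. Plus `rfl` lemmas for every field,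
  `taoGate.delayInit_mem_Acore` ((5.6) is a loaded-core input), `taoGate.Φ_delayInit`.
* §6 THE NUMBERS: a gate budget forces `ρ ≤ shadowRadius K ε 2 2 θ = θe^{-2L}`
  (`GateBudget.ρ_le_shadowRadius`; `2L ≥ 16K¹⁰/ε + 16/ε²`), while the input class extends along the
  trigger axis over `kickTolerance K ε = ε²e^{-K¹⁰ + K⁹√K/4} > shadowRadius K ε 2 2 θ`
  (`shadowRadius_lt_kickTolerance`, `GateBudget.ρ_lt_kickTolerance`): the certified input class is a
  THIN, LONG neighbourhood of the trigger segment.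

## What it says, and what it does NOT say

It says: for Tao's gate, group (A) of the cell's local circuit design is a THEOREM with explicit
constants — no interval arithmetic is needed, the tree's bootstrap proof of Theorem 5.3
(`DelayCircuitHolds.lean`, lit seat) and its kicked re-run (`TriggerTolerance.lean`) ARE the
validated computation, and the Grönwall budget is the cell's `gronwallBound`. The dictionary entry
"Tao's circuit element ↔ gadget-interface field" for the gate is thereby kernel-checked in the form:
what the averaged construction gets for free ⊇ `GateCertificate` (here, for all admissible `K, ε`);
what the true equations must supply = `GatePhysics` (every field a hypothesis; for the averaged
equation of §6 of the paper they are supplied BY DESIGN of the averaging, which is not formalised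
here). It does NOT say anything about Navier–Stokes: no `GatePhysics S (Fin 5 → ℝ) s (taoGate h)`
is constructed or claimed; given one, `(taoGate h).localCircuit P : LocalCircuit S _ s` feeds the
cell's `FluidComputerLocal.lean` — an implication from a hypothesis list. HONEST CEILING of the
certificate itself: it is the WORST-CASE (Grönwall) budget, so the admissible defect is
`εd ≤ θe^{-2L}/2` with `2L ≥ 16/ε² ≥ 16e^{20K¹⁰}` — absurdly small; Tao's §6 does not pay this price
because his forcing is structured (the averaging kills the dangerous cross terms), and
`TriggerFragility.lean` shows the trigger channel really is exponentially fragile beyond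
`kickThreshold`, so a structured-forcing certificate (not a larger Grönwall ball) is what a better
entry would need.

## Design choices

(i) `FluidComputer.LocalCircuit` is IMPORTED (the FluidComputer files do not import this directory;
precedent `SpecDictionary.lean`), so the split (A)/(B) is definitional and checked by `rfl`, not by
prose. (ii) The seven standing hypotheses are ONE `Prop`-structure `GateBudget`, so the certificate
is the term `taoGate h`. (iii) The input class is a neighbourhood of the segment of admissible
pre-loads rather than a ball around (5.6), to record the one-sided extent of the trigger channel.
(iv) No named facts, no `sorry`; `K₀`, `ε₁(K)` are written out as in `TriggerTolerance.lean`.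

## References
* T. Tao, JAMS 29 (2016) 601–674, arXiv:1402.0290, §5.5 (5.5)–(5.6), Theorem 5.3; §1.3. [`Tao2016AveragedNS`]
* E. Hairer, S. P. Nørsett, G. Wanner, *Solving Ordinary Differential Equations I*, 2nd ed.,
  Springer 1993, Thm I.10.2 (the fundamental lemma). [`HairerNorsettWanner1993`]
-/

noncomputable section

open Set Metric
open scoped NNReal ENNReal SchwartzMap Topology

namespace Literature.Analysis.FluidPDE.Tao2016AveragedNS

open Literature.Analysis.FluidPDE.Tao2016 (L2C MemH10df eulerForm IsMildSolutionFor schwartzL2)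
open Literature.Analysis.FluidPDE.FluidComputer (LocalCircuit CascadeSpecs highFreqEnergy
  scaledSobolevNorm)

/-! ## §1. The finite-dimensional half of a local circuit design, as a type -/

/-- **Gate certificate**: the CIRCUIT and REGIONS fields of the cell's `LocalCircuit S O s`
(`FluidComputer/LocalCircuit.lean`), verbatim and nothing else — the part of a local circuit design
that is finite-dimensional ODE data: input / core / output readout classes with a core thickness,
the design vector field `F`, `L`-Lipschitz on an open working region `U`, its flow `Φ` from `Ain`
over rescaled time `[0, τc]`, the admissible defect `ε` per unit rescaled time, the tube radius
`δsh` with the DEFECT BUDGET `gronwallBound 0 L ε τc ≤ δsh`, the TUBE condition and the delayed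
abrupt transition with margin `dat`. [cite: Tao2016AveragedNS, §1.3 pp. 10–11] -/
structure GateCertificate (O : Type*) [NormedAddCommGroup O] [NormedSpace ℝ O] where
  /-- REGIONS: admissible input readouts -/
  Ain : Set O
  /-- loaded-core readouts -/
  Acore : Set O
  /-- output readouts -/
  Aout : Set O
  /-- thickness of the core inside the input region -/
  δ : ℝ
  δ_pos : 0 < δ
  core_thick : ∀ p ∈ Acore, Metric.ball p δ ⊆ Ain
  /-- CIRCUIT: the design vector field (rescaled time) -/
  F : O → O
  /-- the open working region -/
  U : Set O
  U_open : IsOpen U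
  /-- Lipschitz constant of `F` on `U` -/
  L : ℝ≥0
  F_lip : LipschitzOnWith L F U
  /-- the flow of `F` from `Ain`, in rescaled time -/
  Φ : ℝ → O → O
  /-- rescaled cycle time -/
  τc : ℝ
  τc_nonneg : 0 ≤ τc
  flow_zero : ∀ p ∈ Ain, Φ 0 p = p
  flow_cont : ∀ p ∈ Ain, ContinuousOn (fun σ => Φ σ p) (Icc 0 τc)
  flow_deriv : ∀ p ∈ Ain, ∀ σ ∈ Ico 0 τc,
    HasDerivWithinAt (fun σ' => Φ σ' p) (F (Φ σ p)) (Ici σ) σ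
  /-- admissible readout-velocity defect per unit rescaled time -/
  ε : ℝ
  ε_nonneg : 0 ≤ ε
  /-- shadowing tolerance = tube radius -/
  δsh : ℝ
  /-- DEFECT BUDGET `ε (e^{L τc} - 1)/L ≤ δsh` -/
  δsh_ge : gronwallBound 0 L ε τc ≤ δsh
  /-- TUBE -/
  tube : ∀ p ∈ Ain, ∀ σ ∈ Icc 0 τc, Metric.closedBall (Φ σ p) δsh ⊆ U
  /-- delayed abrupt transition with margin -/
  dat : ∀ p ∈ Ain, ∃ σ : ℝ, 0 ≤ σ ∧ σ ≤ τc ∧ Metric.closedBall (Φ σ p) δsh ⊆ Aout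

/-- **Gate physics**: the REMAINING fields of `LocalCircuit S O s` over a given gate certificate `c`
— READOUT (`read`, `recon`, `junk`, their moduli), junk THRESHOLDS, STATICS (`handoff`,
`floor_cert`), LEAK BUDGET, CLOCK, the two GUARDED DYNAMICS inequalities `defect` / `junk_rate`
about every `H¹⁰_df`-mild Navier–Stokes trajectory, and the SEED. For Tao's averaged equation all
of these are supplied by the construction of §6 (the averaging is DESIGNED so that the cross terms
vanish or are `(1+ε₀)^{-n₀/2}`-small); for the true equations every field is a hypothesis.
Nothing asserts an inhabitant exists. [cite: Tao2016AveragedNS, §1.3 pp. 10–11] -/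
structure GatePhysics (S : CascadeSpecs) (O : Type*) [NormedAddCommGroup O] [NormedSpace ℝ O]
    (s : ℝ) (c : GateCertificate O) where
  read : ℕ → L2C → O
  recon : ℕ → O → L2C
  junk : ℕ → L2C → ℝ≥0∞
  Λ : ℝ
  Λ_pos : 0 < Λ
  read_lip : ∀ (n : ℕ) (v w : L2C), dist (read n v) (read n w) * Real.sqrt (S.Emin n) ≤ Λ * ‖v - w‖
  junk_perturb : ∀ (n : ℕ) (v w : L2C), junk n w ≤ junk n v + scaledSobolevNorm s (S.lam n) (w - v)
  s_le_ten : s ≤ 10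
  read_recon : ∀ (n : ℕ) (p : O), read n (recon n p) = p
  junk_recon : ∀ (n : ℕ) (p : O), junk n (recon n p) = 0
  jcore : ℝ
  jin : ℝ
  jrun : ℝ
  jbar : ℝ
  jcore_nonneg : 0 ≤ jcore
  jcore_lt : jcore < jin
  jrun_lt_jbar : jrun < jbar
  handoff : ∀ (n : ℕ) (v : L2C), read n v ∈ c.Aout →
    junk n v ≤ ENNReal.ofReal (jrun * Real.sqrt (S.Emin n)) →
      read (n + 1) v ∈ c.Acore ∧ junk (n + 1) v ≤ ENNReal.ofReal (jcore * Real.sqrt (S.Emin (n + 1)))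
  floor_cert : ∀ (n : ℕ) (v : L2C), read n v ∈ c.Ain →
    junk n v ≤ ENNReal.ofReal (jin * Real.sqrt (S.Emin n)) →
      ENNReal.ofReal (S.Emin n) ≤ highFreqEnergy (S.lam n) v
  γ : ℝ
  γ_nonneg : 0 ≤ γ
  jrun_ge : jin + γ * c.τc ≤ jrun
  unit : ℕ → ℝ
  unit_pos : ∀ n, 0 < unit n
  clock : ∀ n, unit n * c.τc ≤ S.Tmax n
  defect : ∀ (n : ℕ) (a : L2C) (S' : ℝ) (u : ℝ → L2C), IsMildSolutionFor eulerForm a (Ico 0 S') u →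
    ∀ t : ℝ, 0 ≤ t → t < S' → read n (u t) ∈ c.U →
      junk n (u t) < ENNReal.ofReal (jbar * Real.sqrt (S.Emin n)) →
        ∃ W : O, HasDerivWithinAt (fun t' => read n (u t')) W (Ici t) t ∧
          ‖unit n • W - c.F (read n (u t))‖ ≤ c.ε
  junk_rate : ∀ (n : ℕ) (a : L2C) (S' : ℝ) (u : ℝ → L2C),
    IsMildSolutionFor eulerForm a (Ico 0 S') u →
      ∀ t : ℝ, 0 ≤ t → t < S' → read n (u t) ∈ c.U →
        junk n (u t) < ENNReal.ofReal (jbar * Real.sqrt (S.Emin n)) →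
          ∀ ρ : ℝ, γ < ρ → ∃ᶠ t' in 𝓝[>] t,
            junk n (u t') ≤ junk n (u t) + ENNReal.ofReal (ρ * Real.sqrt (S.Emin n) * ((t' - t) / unit n))
  u₀ : 𝓢(EuclideanSpace ℝ (Fin 3), EuclideanSpace ℝ (Fin 3))
  divFree : VectorCalculus.IsDivFree ⇑u₀
  memH10df : MemH10df (schwartzL2 u₀)
  seed_read : read 0 (schwartzL2 u₀) ∈ c.Acore
  seed_junk : junk 0 (schwartzL2 u₀) ≤ ENNReal.ofReal (jcore * Real.sqrt (S.Emin 0))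

namespace GateCertificate

variable {S : CascadeSpecs} {O : Type*} [NormedAddCommGroup O] [NormedSpace ℝ O] {s : ℝ}

/-- **Certificate + physics = local circuit design.** The two structures are, field for field, a
partition of `LocalCircuit S O s`. [cite: Tao2016AveragedNS, §1.3 pp. 10–11] -/
def localCircuit (c : GateCertificate O) (P : GatePhysics S O s c) : LocalCircuit S O s where
  read := P.read
  recon := P.recon
  junk := P.junk
  Λ := P.Λ
  Λ_pos := P.Λ_pos
  read_lip := P.read_lip
  junk_perturb := P.junk_perturb
  s_le_ten := P.s_le_ten
  read_recon := P.read_recon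
  junk_recon := P.junk_recon
  Ain := c.Ain
  Acore := c.Acore
  Aout := c.Aout
  δ := c.δ
  δ_pos := c.δ_pos
  core_thick := c.core_thick
  jcore := P.jcore
  jin := P.jin
  jrun := P.jrun
  jbar := P.jbar
  jcore_nonneg := P.jcore_nonneg
  jcore_lt := P.jcore_lt
  jrun_lt_jbar := P.jrun_lt_jbar
  handoff := P.handoff
  floor_cert := P.floor_cert
  F := c.F
  U := c.U
  U_open := c.U_open
  L := c.L
  F_lip := c.F_lip
  Φ := c.Φ
  τc := c.τc
  τc_nonneg := c.τc_nonneg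
  flow_zero := c.flow_zero
  flow_cont := c.flow_cont
  flow_deriv := c.flow_deriv
  ε := c.ε
  ε_nonneg := c.ε_nonneg
  δsh := c.δsh
  δsh_ge := c.δsh_ge
  tube := c.tube
  dat := c.dat
  γ := P.γ
  γ_nonneg := P.γ_nonneg
  jrun_ge := P.jrun_ge
  unit := P.unit
  unit_pos := P.unit_pos
  clock := P.clock
  defect := P.defect
  junk_rate := P.junk_rate
  u₀ := P.u₀
  divFree := P.divFree
  memH10df := P.memH10df
  seed_read := P.seed_read
  seed_junk := P.seed_junk

/-- The assembled design's vector field is the certificate's. [folklore] -/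
@[simp] theorem localCircuit_F (c : GateCertificate O) (P : GatePhysics S O s c) :
    (c.localCircuit P).F = c.F := rfl

/-- The assembled design's flow is the certificate's. [folklore] -/
@[simp] theorem localCircuit_Φ (c : GateCertificate O) (P : GatePhysics S O s c) :
    (c.localCircuit P).Φ = c.Φ := rfl

/-- The assembled design's tube radius is the certificate's. [folklore] -/
@[simp] theorem localCircuit_δsh (c : GateCertificate O) (P : GatePhysics S O s c) :
    (c.localCircuit P).δsh = c.δsh := rfl

/-- The assembled design's admissible defect is the certificate's. [folklore] -/
@[simp] theorem localCircuit_ε (c : GateCertificate O) (P : GatePhysics S O s c) :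
    (c.localCircuit P).ε = c.ε := rfl

/-- The assembled design's readout is the physics'. [folklore] -/
@[simp] theorem localCircuit_read (c : GateCertificate O) (P : GatePhysics S O s c) :
    (c.localCircuit P).read = P.read := rfl

/-- The assembled design's seed is the physics'. [folklore] -/
@[simp] theorem localCircuit_u₀ (c : GateCertificate O) (P : GatePhysics S O s c) :
    (c.localCircuit P).u₀ = P.u₀ := rfl

end GateCertificate

/-- Conversely every local circuit design has a gate certificate (projection) … [folklore] -/
def _root_.Literature.Analysis.FluidPDE.FluidComputer.LocalCircuit.gateCertificate
    {S : CascadeSpecs} {O : Type*} [NormedAddCommGroup O] [NormedSpace ℝ O] {s : ℝ}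
    (A : LocalCircuit S O s) : GateCertificate O where
  Ain := A.Ain
  Acore := A.Acore
  Aout := A.Aout
  δ := A.δ
  δ_pos := A.δ_pos
  core_thick := A.core_thick
  F := A.F
  U := A.U
  U_open := A.U_open
  L := A.L
  F_lip := A.F_lip
  Φ := A.Φ
  τc := A.τc
  τc_nonneg := A.τc_nonneg
  flow_zero := A.flow_zero
  flow_cont := A.flow_cont
  flow_deriv := A.flow_deriv
  ε := A.ε
  ε_nonneg := A.ε_nonneg
  δsh := A.δsh
  δsh_ge := A.δsh_ge
  tube := A.tube
  dat := A.dat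

/-- … and a gate physics over it (projection). [folklore] -/
def _root_.Literature.Analysis.FluidPDE.FluidComputer.LocalCircuit.gatePhysics
    {S : CascadeSpecs} {O : Type*} [NormedAddCommGroup O] [NormedSpace ℝ O] {s : ℝ}
    (A : LocalCircuit S O s) : GatePhysics S O s A.gateCertificate where
  read := A.read
  recon := A.recon
  junk := A.junk
  Λ := A.Λ
  Λ_pos := A.Λ_pos
  read_lip := A.read_lip
  junk_perturb := A.junk_perturb
  s_le_ten := A.s_le_ten
  read_recon := A.read_recon
  junk_recon := A.junk_recon
  jcore := A.jcore
  jin := A.jin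
  jrun := A.jrun
  jbar := A.jbar
  jcore_nonneg := A.jcore_nonneg
  jcore_lt := A.jcore_lt
  jrun_lt_jbar := A.jrun_lt_jbar
  handoff := A.handoff
  floor_cert := A.floor_cert
  γ := A.γ
  γ_nonneg := A.γ_nonneg
  jrun_ge := A.jrun_ge
  unit := A.unit
  unit_pos := A.unit_pos
  clock := A.clock
  defect := A.defect
  junk_rate := A.junk_rate
  u₀ := A.u₀
  divFree := A.divFree
  memH10df := A.memH10df
  seed_read := A.seed_read
  seed_junk := A.seed_junk

/-- **The split is exact**: reassembling the two projections returns the design. [folklore] -/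
theorem _root_.Literature.Analysis.FluidPDE.FluidComputer.LocalCircuit.localCircuit_gateCertificate
    {S : CascadeSpecs} {O : Type*} [NormedAddCommGroup O] [NormedSpace ℝ O] {s : ℝ}
    (A : LocalCircuit S O s) : A.gateCertificate.localCircuit A.gatePhysics = A := by
  cases A; rfl

/-! ## §2. The flow of the delay circuit (5.5) from an arbitrary state -/

/-- (5.5) is globally well posed from EVERY state (energy conservation; `GlobalWellposedness`).
[cite: Tao2016AveragedNS, §5 (ode)–(g-cancel)] -/
theorem delayCircuit_exists_solution_from (K ε : ℝ) (p : Fin 5 → ℝ) :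
    ∃ X : ℝ → Fin 5 → ℝ, X 0 = p ∧ ∀ t, HasDerivAt X (delayCircuit K ε (X t)) t :=
  (isCancelling_delayCircuit K ε).exists_solution (contDiff_delayCircuit K ε) p

/-- **The flow of (5.5)**: `delayFlow K ε σ p` = the state at (rescaled) time `σ` of the global
trajectory of the delay circuit issued from `p` (definition by choice; characterised by
`delayFlow_zero`, `hasDerivAt_delayFlow` and uniqueness `delayFlow_eq_of_hasDerivAt`).
[cite: Tao2016AveragedNS, §5.5 (5.5)] -/
def delayFlow (K ε : ℝ) (σ : ℝ) (p : Fin 5 → ℝ) : Fin 5 → ℝ :=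
  (delayCircuit_exists_solution_from K ε p).choose σ

/-- The flow starts at the datum. [cite: Tao2016AveragedNS, §5.5 (5.5)] -/
theorem delayFlow_zero (K ε : ℝ) (p : Fin 5 → ℝ) : delayFlow K ε 0 p = p :=
  (delayCircuit_exists_solution_from K ε p).choose_spec.1

/-- The flow solves (5.5) for all times. [cite: Tao2016AveragedNS, §5.5 (5.5)] -/
theorem hasDerivAt_delayFlow (K ε : ℝ) (p : Fin 5 → ℝ) (σ : ℝ) :
    HasDerivAt (fun σ' => delayFlow K ε σ' p) (delayCircuit K ε (delayFlow K ε σ p)) σ :=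
  (delayCircuit_exists_solution_from K ε p).choose_spec.2 σ

/-- Uniqueness: a global trajectory of (5.5) IS the flow line of its initial state.
[cite: Tao2016AveragedNS, §5.5 (5.5)] -/
theorem delayFlow_eq_of_hasDerivAt {K ε : ℝ} {X : ℝ → Fin 5 → ℝ}
    (hX : ∀ t, HasDerivAt X (delayCircuit K ε (X t)) t) :
    (fun σ => delayFlow K ε σ (X 0)) = X :=
  delayCircuit_solution_unique K ε (hasDerivAt_delayFlow K ε (X 0)) hX (delayFlow_zero K ε _)

/-- The flow line of (5.6) is THE trajectory `delaySolution K ε`. [cite: Tao2016AveragedNS, §5.5 (5.6)] -/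
theorem delayFlow_delayInit (K ε : ℝ) : (fun σ => delayFlow K ε σ delayInit) = delaySolution K ε := by
  have h := delayFlow_eq_of_hasDerivAt (hasDerivAt_delaySolution K ε)
  rwa [delaySolution_zero] at h

/-- Energy is conserved along the flow. [cite: Tao2016AveragedNS, §5.5 (energy-con)] -/
theorem energy_delayFlow (K ε : ℝ) (p : Fin 5 → ℝ) (σ : ℝ) :
    energy (delayFlow K ε σ p) = energy p := by
  have h := energy_eq_of_isCancelling (isCancelling_delayCircuit K ε) (hasDerivAt_delayFlow K ε p) σ 0
  rwa [delayFlow_zero] at h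

/-- The flow line stays in the sup-ball of radius `√(energy p)`. [cite: Tao2016AveragedNS, §5.5 (energy-con)] -/
theorem norm_delayFlow_le (K ε : ℝ) (p : Fin 5 → ℝ) (σ : ℝ) :
    ‖delayFlow K ε σ p‖ ≤ Real.sqrt (energy p) := by
  simpa [energy_delayFlow] using norm_le_sqrt_energy (delayFlow K ε σ p)

/-- Flow lines are continuous. [folklore] -/
theorem continuous_delayFlow (K ε : ℝ) (p : Fin 5 → ℝ) : Continuous fun σ => delayFlow K ε σ p :=
  continuous_iff_continuousAt.2 fun σ => (hasDerivAt_delayFlow K ε p σ).continuousAt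


/-! ## §3. Firing along pseudo-orbits near ANY firing trajectory of (5.5): kick and defect at once -/

/-- **Firing on a budget near an arbitrary firing trajectory.** Let `X` be a global trajectory of
(5.5) in the unit sup-ball performing the delayed abrupt transition with constants `C, K`
(`HasAbruptTransition C K X`) — e.g. THE trajectory from (5.6) (Theorem 5.3), or the trajectory from
a kicked datum `kickInit κ`, `κ ≤ kickTolerance K ε` (`kick_hasAbruptTransition`). Then every
`δ`-pseudo-orbit `Y` of (5.5) over `[0,T]` in the sup-ball of radius `R ≥ 1`, issued `δ₀`-close to
`X 0`, with forcing budget `(δ₀ + δT)·exp(delayLipschitz K ε R · T) ≤ θ`, performs it too on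
`[0,T]` with efficiency loss `θ`: before `t_c - K^{-1/2}` the input mode is within `C K⁻¹⁰ + θ` of `1`
and the other modes are `≤ C K⁻¹⁰ + θ`; from `t_c + K^{-1/2}` on the output mode is
`≥ 1 - C K⁻¹⁰ - θ` and the other modes are `≤ C K⁻¹⁰ + θ` (the fundamental lemma
`IsPseudoOrbit.norm_sub_le` against the `0`-pseudo-orbit `X`; generalises `fires_of_budget`, whose
reference is (5.6)). [cite: HairerNorsettWanner1993, Thm I.10.2] -/
theorem IsPseudoOrbit.fires_near {K ε δ T δ₀ C θ : ℝ} {R : ℝ≥0} {X Y : ℝ → Fin 5 → ℝ}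
    (hY : IsPseudoOrbit (delayCircuit K ε) δ R T Y) (hR : 1 ≤ R)
    (hX : ∀ t, HasDerivAt X (delayCircuit K ε (X t)) t) (hX1 : ∀ t, ‖X t‖ ≤ 1)
    (h0 : ‖Y 0 - X 0‖ ≤ δ₀) (hδ : 0 ≤ δ) (hT : HasAbruptTransition C K X)
    (hθ : (δ₀ + δ * T) * Real.exp (delayLipschitz K ε R * T) ≤ θ) :
    ∃ tc : ℝ, |tc - Real.sqrt 2| ≤ C / Real.sqrt K ∧
      (∀ t ∈ Icc 0 T, t ≤ tc - 1 / Real.sqrt K →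
        |Y t 0 - 1| ≤ C / K ^ 10 + θ ∧ ∀ i : Fin 5, i ≠ 0 → |Y t i| ≤ C / K ^ 10 + θ) ∧
      (∀ t ∈ Icc 0 T, tc + 1 / Real.sqrt K ≤ t →
        1 - C / K ^ 10 - θ ≤ Y t 4 ∧ ∀ i : Fin 5, i ≠ 4 → |Y t i| ≤ C / K ^ 10 + θ) := by
  have hδ₀ : 0 ≤ δ₀ := (norm_nonneg _).trans h0
  have hL : (0 : ℝ) ≤ delayLipschitz K ε R := NNReal.coe_nonneg _
  have hXpo : IsPseudoOrbit (delayCircuit K ε) 0 R T X :=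
    IsPseudoOrbit.of_hasDerivAt hX fun t _ => (hX1 t).trans (NNReal.one_le_coe.2 hR)
  -- the shadowing error against `X` is below `θ` on the whole window
  have hg : ∀ t ∈ Icc 0 T, ‖Y t - X t‖ ≤ θ := by
    intro t ht
    have h1 := hY.norm_sub_le (lipschitzOnWith_delayCircuit K ε R) hXpo h0 ht
    rw [add_zero] at h1
    refine h1.trans ((Literature.Analysis.ODE.gronwallBound_le_mul_exp (x := t) hδ hL).trans
      (le_trans ?_ hθ))
    have hT : t ≤ T := ht.2
    have hT0 : 0 ≤ T := ht.1.trans ht.2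
    gcongr
  obtain ⟨tc, htc, hbefore, hafter⟩ := hT
  refine ⟨tc, htc, fun t ht htb => ?_, fun t ht hta => ?_⟩
  · obtain ⟨ha, hi⟩ := hbefore t ⟨ht.1, htb⟩
    exact ⟨abs_sub_le_of_norm_sub_le (hg t ht) ha,
      fun i hne => abs_le_of_norm_sub_le (hg t ht) (hi i hne)⟩
  · obtain ⟨ha, hi⟩ := hafter t hta
    refine ⟨?_, fun i hne => abs_le_of_norm_sub_le (hg t ht) (hi i hne)⟩
    have := (abs_sub_le_iff.1 (abs_sub_le_of_norm_sub_le (hg t ht) ha)).2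
    linarith

/-- **Kick + defect at once (Theorem 5.3 along pseudo-orbits from kicked data).** For `K ≥ K₀`,
`0 < ε ≤ ε₁(K)` (the constants of the tree's proof of Theorem 5.3) and a trigger pre-load
`0 ≤ κ ≤ kickTolerance K ε`: every `δ`-pseudo-orbit of (5.5) over `[0,T]` in the sup-ball of radius
`R ≥ 1`, issued `δ₀`-close to the kicked datum `kickInit κ = (√(1-κ²), 0, κ, 0, 0)`, with forcing
budget `(δ₀ + δT)·exp(delayLipschitz K ε R · T) ≤ θ`, performs the delayed abrupt transition with
`C = 200` up to the efficiency loss `θ` — the c-channel tolerance of `TriggerTolerance.lean` and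
the Grönwall defect channel of `CircuitShadowing.lean` combined. [cite: Tao2016AveragedNS, Theorem 5.3] -/
theorem kicked_pseudoOrbit_fires {K ε κ δ T δ₀ θ : ℝ} {R : ℝ≥0} {Y : ℝ → Fin 5 → ℝ}
    (hK : (8 : ℝ) ^ 111 * (Nat.factorial 111 : ℝ) + 2 * 20 ^ 42 * (Nat.factorial 42 : ℝ) + 16 ≤ K)
    (hε : 0 < ε) (hεle : ε ≤ Real.exp (-(10 * K ^ 10)) / K ^ 100) (hκ0 : 0 ≤ κ)
    (hκ : κ ≤ kickTolerance K ε) (hY : IsPseudoOrbit (delayCircuit K ε) δ R T Y) (hR : 1 ≤ R)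
    (h0 : ‖Y 0 - kickInit κ‖ ≤ δ₀) (hδ : 0 ≤ δ)
    (hθ : (δ₀ + δ * T) * Real.exp (delayLipschitz K ε R * T) ≤ θ) :
    ∃ tc : ℝ, |tc - Real.sqrt 2| ≤ 200 / Real.sqrt K ∧
      (∀ t ∈ Icc 0 T, t ≤ tc - 1 / Real.sqrt K →
        |Y t 0 - 1| ≤ 200 / K ^ 10 + θ ∧ ∀ i : Fin 5, i ≠ 0 → |Y t i| ≤ 200 / K ^ 10 + θ) ∧
      (∀ t ∈ Icc 0 T, tc + 1 / Real.sqrt K ≤ t →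
        1 - 200 / K ^ 10 - θ ≤ Y t 4 ∧ ∀ i : Fin 5, i ≠ 4 → |Y t i| ≤ 200 / K ^ 10 + θ) := by
  set X : ℝ → Fin 5 → ℝ := fun t => delayFlow K ε t (kickInit κ) with hXdef
  have hX : ∀ t, HasDerivAt X (delayCircuit K ε (X t)) t := hasDerivAt_delayFlow K ε (kickInit κ)
  have hX0 : X 0 = kickInit κ := delayFlow_zero K ε _
  have hK16 : 16 ≤ K := (K0_facts hK).1
  have hK1 : 1 ≤ K := by linarith
  obtain ⟨hε1, -, -, -⟩ := Thm53.eps_facts hK16 hε hεle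
  have hk : Thm53Kick.IsKicked K ε κ X := Thm53Kick.IsKicked.of_le_tolerance hK1 hε hε1 hκ0 hκ hX0
  have hX1 : ∀ t, ‖X t‖ ≤ 1 := kick_norm_le_one hX hX0 hk.sq_le_one
  have hAT : HasAbruptTransition 200 K X := kick_hasAbruptTransition hK hε hεle hκ0 hκ hX0 hX
  have h0' : ‖Y 0 - X 0‖ ≤ δ₀ := by rwa [hX0]
  exact hY.fires_near hR hX hX1 h0' hδ hAT hθ

/-! ## §4. The regions of the gate: the trigger-tolerant input class and the fired output class -/

/-- **Input class** of the gate with thickness `ρ`: states within sup-distance `ρ` of a kicked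
datum `kickInit κ`, `0 ≤ κ ≤ kickTolerance K ε` — a `ρ`-neighbourhood of the segment of admissible
trigger pre-loads through (5.6). [cite: Tao2016AveragedNS, §5.5 (5.6)] -/
def trigIn (K ε ρ : ℝ) : Set (Fin 5 → ℝ) :=
  {p | ∃ κ : ℝ, 0 ≤ κ ∧ κ ≤ kickTolerance K ε ∧ ‖p - kickInit κ‖ ≤ ρ}

/-- **Output (fired) class** with constants `C, K` and efficiency loss `θ`: output mode
`ã ≥ 1 - C K⁻¹⁰ - θ`, every other mode `≤ C K⁻¹⁰ + θ` in absolute value — the second window of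
Theorem 5.3, widened by `θ`. [cite: Tao2016AveragedNS, Theorem 5.3] -/
def firedOut (C K θ : ℝ) : Set (Fin 5 → ℝ) :=
  {Y | 1 - C / K ^ 10 - θ ≤ Y 4 ∧ ∀ i : Fin 5, i ≠ 4 → |Y i| ≤ C / K ^ 10 + θ}

/-- Membership in the input class, unfolded. [folklore] -/
theorem mem_trigIn_iff {K ε ρ : ℝ} {p : Fin 5 → ℝ} :
    p ∈ trigIn K ε ρ ↔ ∃ κ : ℝ, 0 ≤ κ ∧ κ ≤ kickTolerance K ε ∧ ‖p - kickInit κ‖ ≤ ρ := Iff.rfl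

/-- Membership in the fired class, unfolded. [folklore] -/
theorem mem_firedOut_iff {C K θ : ℝ} {Y : Fin 5 → ℝ} :
    Y ∈ firedOut C K θ ↔ 1 - C / K ^ 10 - θ ≤ Y 4 ∧ ∀ i : Fin 5, i ≠ 4 → |Y i| ≤ C / K ^ 10 + θ :=
  Iff.rfl

/-- Kicked data below the tolerance are admissible inputs. [cite: Tao2016AveragedNS, §5.5 (5.6)] -/
theorem kickInit_mem_trigIn {K ε ρ κ : ℝ} (hρ : 0 ≤ ρ) (hκ0 : 0 ≤ κ) (hκ : κ ≤ kickTolerance K ε) :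
    kickInit κ ∈ trigIn K ε ρ :=
  ⟨κ, hκ0, hκ, by simpa using hρ⟩

/-- The designed datum (5.6) is an admissible input (`ε ≠ 0`). [cite: Tao2016AveragedNS, §5.5 (5.6)] -/
theorem delayInit_mem_trigIn {K ε ρ : ℝ} (hρ : 0 ≤ ρ) (hε : 0 < ε) : delayInit ∈ trigIn K ε ρ := by
  rw [← kickInit_zero]
  exact kickInit_mem_trigIn hρ le_rfl (kickTolerance_pos hε).le

/-- The input classes are monotone in the thickness. [folklore] -/
theorem trigIn_mono {K ε ρ ρ' : ℝ} (h : ρ ≤ ρ') : trigIn K ε ρ ⊆ trigIn K ε ρ' :=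
  fun _ ⟨κ, hκ0, hκ, hp⟩ => ⟨κ, hκ0, hκ, hp.trans h⟩

/-- A `ρ'`-ball around a point of the `ρ`-class lies in the `(ρ + ρ')`-class. [folklore] -/
theorem ball_subset_trigIn {K ε ρ ρ' : ℝ} {p : Fin 5 → ℝ} (hp : p ∈ trigIn K ε ρ) :
    Metric.ball p ρ' ⊆ trigIn K ε (ρ + ρ') := by
  obtain ⟨κ, hκ0, hκ, hpk⟩ := hp
  intro y hy
  refine ⟨κ, hκ0, hκ, ?_⟩
  rw [Metric.mem_ball, dist_eq_norm] at hy
  calc ‖y - kickInit κ‖ = ‖(y - p) + (p - kickInit κ)‖ := by congr 1; abel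
    _ ≤ ‖y - p‖ + ‖p - kickInit κ‖ := norm_add_le _ _
    _ ≤ ρ + ρ' := by linarith

/-- Energy near a unit-energy state: `‖p - q‖_∞ ≤ ρ`, `energy q = 1` ⇒ `energy p ≤ 2 + 10ρ²`
(`(qᵢ + dᵢ)² ≤ 2qᵢ² + 2dᵢ²`, five modes). [folklore] -/
theorem energy_le_of_norm_sub_le {p q : Fin 5 → ℝ} {ρ : ℝ} (hq : energy q = 1)
    (h : ‖p - q‖ ≤ ρ) : energy p ≤ 2 + 10 * ρ ^ 2 := by
  have hd : ∀ i, (p i - q i) ^ 2 ≤ ρ ^ 2 := fun i => by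
    have h1 : |p i - q i| ≤ ρ := by
      have := norm_le_pi_norm (p - q) i
      rw [Pi.sub_apply, Real.norm_eq_abs] at this
      exact this.trans h
    calc (p i - q i) ^ 2 = |p i - q i| ^ 2 := (sq_abs _).symm
      _ ≤ ρ ^ 2 := pow_le_pow_left₀ (abs_nonneg _) h1 2
  have hpt : ∀ i, p i ^ 2 ≤ 2 * q i ^ 2 + 2 * ρ ^ 2 := fun i => by
    nlinarith [hd i, sq_nonneg (p i - 2 * q i)]
  have hq' : ∑ i, q i ^ 2 = 1 := hq
  calc energy p = ∑ i, p i ^ 2 := rfl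
    _ ≤ ∑ i, (2 * q i ^ 2 + 2 * ρ ^ 2) := Finset.sum_le_sum fun i _ => hpt i
    _ = 2 * ∑ i, q i ^ 2 + 10 * ρ ^ 2 := by
        rw [Finset.sum_add_distrib, ← Finset.mul_sum, Finset.sum_const, Finset.card_univ,
          Fintype.card_fin]
        simp only [nsmul_eq_mul, Nat.cast_ofNat]
        ring
    _ = 2 + 10 * ρ ^ 2 := by rw [hq']; ring

/-- Kicks below the tolerance have `κ² ≤ 1` (`K ≥ 1`, `|ε| ≤ 1`). [folklore] -/
theorem sq_le_one_of_le_kickTolerance {K ε κ : ℝ} (hK : 1 ≤ K) (hε1 : ε ≤ 1) (hε0 : 0 ≤ ε)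
    (hκ0 : 0 ≤ κ) (hκ : κ ≤ kickTolerance K ε) : κ ^ 2 ≤ 1 := by
  have h1 : κ ≤ ε ^ 2 / 2 := hκ.trans (kickTolerance_le_half_sq hK)
  have h2 : ε ^ 2 ≤ 1 := by nlinarith
  have h3 : κ ≤ 1 := by linarith
  exact pow_le_one₀ hκ0 h3

/-- States of the input class of thickness `ρ ≤ 1/4` have energy `≤ 2 + 10ρ² ≤ (17/10)²`, hence
their flow lines stay in the sup-ball of radius `17/10` (`K ≥ 1`, `0 ≤ ε ≤ 1`).
[cite: Tao2016AveragedNS, §5.5 (energy-con)] -/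
theorem norm_delayFlow_le_of_mem_trigIn {K ε ρ : ℝ} {p : Fin 5 → ℝ} (hK : 1 ≤ K) (hε0 : 0 ≤ ε)
    (hε1 : ε ≤ 1) (hρ : ρ ≤ 1 / 4) (hp : p ∈ trigIn K ε ρ) (K' ε' σ : ℝ) :
    ‖delayFlow K' ε' σ p‖ ≤ 17 / 10 := by
  obtain ⟨κ, hκ0, hκ, hpk⟩ := hp
  have hρ0 : 0 ≤ ρ := (norm_nonneg _).trans hpk
  have hE : energy p ≤ 2 + 10 * ρ ^ 2 :=
    energy_le_of_norm_sub_le (energy_kickInit (sq_le_one_of_le_kickTolerance hK hε1 hε0 hκ0 hκ)) hpk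
  have hE' : energy p ≤ (17 / 10) ^ 2 := by nlinarith
  exact (norm_delayFlow_le K' ε' p σ).trans ((Real.sqrt_le_left (by norm_num)).2 hE')

/-! ## §5. The certificate of Tao's gate -/

/-- **The forcing budget of the gate** (the standing hypotheses of the certificate): `K ≥ K₀` and
`0 < ε ≤ ε₁(K) = e^{-10K¹⁰}/K¹⁰⁰` (the constants of the tree's proof of Theorem 5.3), an input
thickness `ρ > 0`, an admissible defect `εd ≥ 0` per unit rescaled time, and an efficiency loss
`θ ≤ 1/4`, tied by the GRÖNWALL BUDGET over the cycle `[0,2]` in the sup-ball of radius `2`: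
`(ρ + 2εd)·exp(2·delayLipschitz K ε 2) ≤ θ`, i.e. `ρ + 2εd ≤ shadowRadius K ε 2 2 θ`
(`GateBudget.of_le_shadowRadius`). [cite: HairerNorsettWanner1993, Thm I.10.2] -/
structure GateBudget (K ε ρ εd θ : ℝ) : Prop where
  hK : (8 : ℝ) ^ 111 * (Nat.factorial 111 : ℝ) + 2 * 20 ^ 42 * (Nat.factorial 42 : ℝ) + 16 ≤ K
  ε_pos : 0 < ε
  ε_le : ε ≤ Real.exp (-(10 * K ^ 10)) / K ^ 100
  ρ_pos : 0 < ρ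
  εd_nonneg : 0 ≤ εd
  θ_le : θ ≤ 1 / 4
  budget : (ρ + εd * 2) * Real.exp (delayLipschitz K ε 2 * 2) ≤ θ

namespace GateBudget

variable {K ε ρ εd θ : ℝ}

/-- A budget below the shadow radius is a gate budget. [cite: HairerNorsettWanner1993, Thm I.10.2] -/
theorem of_le_shadowRadius
    (hK : (8 : ℝ) ^ 111 * (Nat.factorial 111 : ℝ) + 2 * 20 ^ 42 * (Nat.factorial 42 : ℝ) + 16 ≤ K)
    (hε : 0 < ε) (hεle : ε ≤ Real.exp (-(10 * K ^ 10)) / K ^ 100) (hρ : 0 < ρ) (hεd : 0 ≤ εd)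
    (hθ : θ ≤ 1 / 4) (h : ρ + εd * 2 ≤ shadowRadius K ε 2 2 θ) : GateBudget K ε ρ εd θ :=
  ⟨hK, hε, hεle, hρ, hεd, hθ, budget_of_le_shadowRadius h⟩

/-- `K ≥ K₀ ≥ 16`. [folklore] -/
theorem sixteen_le (h : GateBudget K ε ρ εd θ) : 16 ≤ K := (K0_facts h.hK).1

/-- `K ≥ 1`. [folklore] -/
theorem one_le (h : GateBudget K ε ρ εd θ) : 1 ≤ K := by linarith [h.sixteen_le]

/-- `ε ≤ ε₁(K) ≤ 1`. [folklore] -/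
theorem ε_le_one (h : GateBudget K ε ρ εd θ) : ε ≤ 1 :=
  (Thm53.eps_facts h.sixteen_le h.ε_pos h.ε_le).1

/-- `e^{2L} ≥ 1`, so `ρ ≤ ρe^{2L} ≤ θ ≤ 1/4`, `2εd e^{2L} ≤ θ - ρe^{2L}`, `θ > 0`. [folklore] -/
theorem one_le_exp : 1 ≤ Real.exp (delayLipschitz K ε 2 * 2) :=
  Real.one_le_exp (mul_nonneg (NNReal.coe_nonneg _) (by norm_num))

/-- `ρe^{2L} ≤ θ`. [folklore] -/
theorem ρ_mul_exp_le (h : GateBudget K ε ρ εd θ) :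
    ρ * Real.exp (delayLipschitz K ε 2 * 2) ≤ θ := by
  have hb := h.budget
  have hE := (one_le_exp (K := K) (ε := ε))
  nlinarith [h.εd_nonneg, h.ρ_pos]

/-- `ρ ≤ θ`. [folklore] -/
theorem ρ_le_θ (h : GateBudget K ε ρ εd θ) : ρ ≤ θ :=
  le_trans (le_mul_of_one_le_right h.ρ_pos.le one_le_exp) h.ρ_mul_exp_le

/-- `θ > 0`. [folklore] -/
theorem θ_pos (h : GateBudget K ε ρ εd θ) : 0 < θ := h.ρ_pos.trans_le h.ρ_le_θ

/-- `ρ ≤ 1/4`. [folklore] -/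
theorem ρ_le_quarter (h : GateBudget K ε ρ εd θ) : ρ ≤ 1 / 4 := h.ρ_le_θ.trans h.θ_le

/-- The tube radius of the certificate: `δsh = θ - ρe^{2L}`. [folklore] -/
theorem defect_budget (h : GateBudget K ε ρ εd θ) :
    εd * 2 * Real.exp (delayLipschitz K ε 2 * 2) ≤ θ - ρ * Real.exp (delayLipschitz K ε 2 * 2) := by
  have hb := h.budget
  rw [add_mul] at hb
  linarith

/-- The tube radius is non-negative. [folklore] -/
theorem δsh_nonneg (h : GateBudget K ε ρ εd θ) :
    0 ≤ θ - ρ * Real.exp (delayLipschitz K ε 2 * 2) :=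
  le_trans (by have := h.εd_nonneg; positivity) h.defect_budget

/-- The tube radius is at most the efficiency loss. [folklore] -/
theorem δsh_le_θ (h : GateBudget K ε ρ εd θ) :
    θ - ρ * Real.exp (delayLipschitz K ε 2 * 2) ≤ θ := by
  have : 0 ≤ ρ * Real.exp (delayLipschitz K ε 2 * 2) := by have := h.ρ_pos; positivity
  linarith

/-- TUBE: flow lines from the input class, thickened by `δsh ≤ θ ≤ 1/4`, stay in the open sup-ball
of radius `2` (`17/10 + 1/4 < 2`). [cite: Tao2016AveragedNS, §5.5 (energy-con)] -/
theorem tube (h : GateBudget K ε ρ εd θ) {p : Fin 5 → ℝ} (hp : p ∈ trigIn K ε ρ) (σ : ℝ) :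
    Metric.closedBall (delayFlow K ε σ p) (θ - ρ * Real.exp (delayLipschitz K ε 2 * 2)) ⊆
      Metric.ball 0 2 := by
  intro Y hY
  rw [Metric.mem_closedBall, dist_eq_norm] at hY
  rw [Metric.mem_ball, dist_zero_right]
  have h17 := norm_delayFlow_le_of_mem_trigIn h.one_le h.ε_pos.le h.ε_le_one h.ρ_le_quarter hp K ε σ
  calc ‖Y‖ = ‖(Y - delayFlow K ε σ p) + delayFlow K ε σ p‖ := by congr 1; abel
    _ ≤ ‖Y - delayFlow K ε σ p‖ + ‖delayFlow K ε σ p‖ := norm_add_le _ _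
    _ < 2 := by linarith [h.δsh_le_θ, h.θ_le]

/-- DELAYED ABRUPT TRANSITION WITH MARGIN: from every state of the input class the flow reaches, at
the rescaled time `σ = t_c + K^{-1/2} ∈ [0,2]` of the kicked reference trajectory through the
nearest admissible pre-load, a point whose closed `δsh`-ball lies in the fired class
`firedOut 200 K θ` (Theorem 5.3 for kicked data + Grönwall between two exact trajectories:
`ρe^{Lσ} + δsh ≤ θ`). [cite: Tao2016AveragedNS, Theorem 5.3] -/
theorem dat (h : GateBudget K ε ρ εd θ) {p : Fin 5 → ℝ} (hp : p ∈ trigIn K ε ρ) :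
    ∃ σ : ℝ, 0 ≤ σ ∧ σ ≤ 2 ∧
      Metric.closedBall (delayFlow K ε σ p) (θ - ρ * Real.exp (delayLipschitz K ε 2 * 2)) ⊆
        firedOut 200 K θ := by
  obtain ⟨κ, hκ0, hκ, hpk⟩ := hp
  set X : ℝ → Fin 5 → ℝ := fun t => delayFlow K ε t (kickInit κ) with hXdef
  have hX : ∀ t, HasDerivAt X (delayCircuit K ε (X t)) t := hasDerivAt_delayFlow K ε (kickInit κ)
  have hX0 : X 0 = kickInit κ := delayFlow_zero K ε _
  have hκsq : κ ^ 2 ≤ 1 := sq_le_one_of_le_kickTolerance h.one_le h.ε_le_one h.ε_pos.le hκ0 hκ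
  have hX1 : ∀ t, ‖X t‖ ≤ 1 := kick_norm_le_one hX hX0 hκsq
  obtain ⟨tc, htc, -, hafter⟩ := kick_hasAbruptTransition h.hK h.ε_pos h.ε_le hκ0 hκ hX0 hX
  obtain ⟨hK16, hs512, h202⟩ := K0_facts h.hK
  have hsK : 0 < Real.sqrt K := by linarith
  -- the firing instant
  set σ : ℝ := tc + 1 / Real.sqrt K with hσdef
  have hs1 : 1 / Real.sqrt K ≤ 2 / 5 := by
    rw [div_le_iff₀ hsK] at h202 ⊢; linarith
  have h200 : 200 / Real.sqrt K ≤ 2 / 5 := by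
    rw [div_le_iff₀ hsK] at h202 ⊢; linarith
  have hs0 : 0 < 1 / Real.sqrt K := by positivity
  have h201 : 200 / Real.sqrt K + 1 / Real.sqrt K ≤ 2 / 5 := by
    rw [← add_div, div_le_iff₀ hsK]; rw [div_le_iff₀ hsK] at h202; linarith
  obtain ⟨htc1, htc2⟩ := abs_le.1 htc
  have h2gt := Thm53.sqrt_two_gt
  have h2lt := Thm53.sqrt_two_lt
  have hσ0 : 0 ≤ σ := by rw [hσdef]; linarith
  have hσ2 : σ ≤ 2 := by rw [hσdef]; linarith
  refine ⟨σ, hσ0, hσ2, fun Y hY => ?_⟩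
  rw [Metric.mem_closedBall, dist_eq_norm] at hY
  -- Grönwall between the two exact trajectories from `p` and from `kickInit κ`
  have hP1 : ∀ t, ‖delayFlow K ε t p‖ ≤ ((2 : ℝ≥0) : ℝ) := fun t =>
    (norm_delayFlow_le_of_mem_trigIn h.one_le h.ε_pos.le h.ε_le_one h.ρ_le_quarter
      ⟨κ, hκ0, hκ, hpk⟩ K ε t).trans (by norm_num)
  have hPpo : IsPseudoOrbit (delayCircuit K ε) 0 2 2 (fun t => delayFlow K ε t p) :=
    IsPseudoOrbit.of_hasDerivAt (hasDerivAt_delayFlow K ε p) fun t _ => hP1 t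
  have hXpo : IsPseudoOrbit (delayCircuit K ε) 0 2 2 X :=
    IsPseudoOrbit.of_hasDerivAt hX fun t _ => (hX1 t).trans (by norm_num)
  have h00 : ‖delayFlow K ε 0 p - X 0‖ ≤ ρ := by rwa [delayFlow_zero, hX0]
  have hgr := hPpo.norm_sub_le (lipschitzOnWith_delayCircuit K ε 2) hXpo h00 ⟨hσ0, hσ2⟩
  rw [add_zero, gronwallBound_ε0] at hgr
  have hL : (0 : ℝ) ≤ delayLipschitz K ε 2 := NNReal.coe_nonneg _
  have hexp : ρ * Real.exp (delayLipschitz K ε 2 * σ) ≤ ρ * Real.exp (delayLipschitz K ε 2 * 2) :=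
    mul_le_mul_of_nonneg_left (Real.exp_le_exp.2 (mul_le_mul_of_nonneg_left hσ2 hL)) h.ρ_pos.le
  -- total distance of `Y` from the reference at the firing instant is `≤ θ`
  have hYX : ‖Y - X σ‖ ≤ θ := by
    calc ‖Y - X σ‖ = ‖(Y - delayFlow K ε σ p) + (delayFlow K ε σ p - X σ)‖ := by congr 1; abel
      _ ≤ ‖Y - delayFlow K ε σ p‖ + ‖delayFlow K ε σ p - X σ‖ := norm_add_le _ _
      _ ≤ (θ - ρ * Real.exp (delayLipschitz K ε 2 * 2)) + ρ * Real.exp (delayLipschitz K ε 2 * 2) :=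
          add_le_add hY (hgr.trans hexp)
      _ = θ := by ring
  obtain ⟨h4, hi⟩ := hafter σ le_rfl
  refine ⟨?_, fun i hne => abs_le_of_norm_sub_le hYX (hi i hne)⟩
  have := (abs_sub_le_iff.1 (abs_sub_le_of_norm_sub_le hYX h4)).2
  linarith

end GateBudget

/-- **TAO'S GATE, CERTIFIED.** Under a gate budget `GateBudget K ε ρ εd θ` the delay circuit (5.5)
inhabits the finite-dimensional half of the cell's local circuit design over `O = ℝ⁵` (sup norm)
with: input class `trigIn K ε ρ` (thickness `ρ` around the admissible trigger pre-loads, core =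
thickness `ρ/2`, core thickness `δ = ρ/2`), output class `firedOut 200 K θ`, design field
`delayCircuit K ε`, working region the open sup-ball of radius `2` with Lipschitz constant
`delayLipschitz K ε 2`, flow `delayFlow K ε`, cycle time `τc = 2`, admissible defect `εd`, tube
radius `δsh = θ - ρ·exp(2·delayLipschitz K ε 2)` — every field a theorem of this directory
(Theorem 5.3 as proved in the tree, its trigger tolerance, global well-posedness, the fundamental
lemma). What is NOT here is `GatePhysics`: everything about Navier–Stokes.
[cite: Tao2016AveragedNS, Theorem 5.3] -/
def taoGate {K ε ρ εd θ : ℝ} (h : GateBudget K ε ρ εd θ) : GateCertificate (Fin 5 → ℝ) where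
  Ain := trigIn K ε ρ
  Acore := trigIn K ε (ρ / 2)
  Aout := firedOut 200 K θ
  δ := ρ / 2
  δ_pos := half_pos h.ρ_pos
  core_thick := fun p hp => by
    have := ball_subset_trigIn (ρ' := ρ / 2) hp
    rwa [add_halves] at this
  F := delayCircuit K ε
  U := Metric.ball 0 2
  U_open := Metric.isOpen_ball
  L := delayLipschitz K ε 2
  F_lip := (lipschitzOnWith_delayCircuit K ε 2).mono Metric.ball_subset_closedBall
  Φ := delayFlow K ε
  τc := 2
  τc_nonneg := by norm_num
  flow_zero := fun p _ => delayFlow_zero K ε p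
  flow_cont := fun p _ => (continuous_delayFlow K ε p).continuousOn
  flow_deriv := fun p _ σ _ => (hasDerivAt_delayFlow K ε p σ).hasDerivWithinAt
  ε := εd
  ε_nonneg := h.εd_nonneg
  δsh := θ - ρ * Real.exp (delayLipschitz K ε 2 * 2)
  δsh_ge := Literature.Analysis.FluidPDE.FluidComputer.gronwallBound_le_of_budget
    (NNReal.coe_nonneg _) h.εd_nonneg h.defect_budget
  tube := fun p hp σ _ => h.tube hp σ
  dat := fun p hp => h.dat hp

namespace taoGate
variable {K ε ρ εd θ : ℝ} (h : GateBudget K ε ρ εd θ)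

/-- Input class of the certified gate: `trigIn K ε ρ`. [cite: Tao2016AveragedNS, §5.5 (5.6)] -/
@[simp] theorem Ain_eq : (taoGate h).Ain = trigIn K ε ρ := rfl

/-- Core class of the certified gate: `trigIn K ε (ρ/2)`. [cite: Tao2016AveragedNS, §5.5 (5.6)] -/
@[simp] theorem Acore_eq : (taoGate h).Acore = trigIn K ε (ρ / 2) := rfl

/-- Output class of the certified gate: `firedOut 200 K θ`. [cite: Tao2016AveragedNS, Theorem 5.3] -/
@[simp] theorem Aout_eq : (taoGate h).Aout = firedOut 200 K θ := rfl

/-- Core thickness of the certified gate: `ρ/2`. [folklore] -/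
@[simp] theorem δ_eq : (taoGate h).δ = ρ / 2 := rfl

/-- Design field of the certified gate: the delay circuit (5.5). [cite: Tao2016AveragedNS, §5.5 (5.5)] -/
@[simp] theorem F_eq : (taoGate h).F = delayCircuit K ε := rfl

/-- Working region of the certified gate: the open sup-ball of radius `2`. [folklore] -/
@[simp] theorem U_eq : (taoGate h).U = Metric.ball 0 2 := rfl

/-- Lipschitz constant of the certified gate: `delayLipschitz K ε 2`. [cite: Tao2016AveragedNS, §5.5 (5.5)] -/
@[simp] theorem L_eq : (taoGate h).L = delayLipschitz K ε 2 := rfl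

/-- Flow of the certified gate: `delayFlow K ε`. [cite: Tao2016AveragedNS, §5.5 (5.5)] -/
@[simp] theorem Φ_eq : (taoGate h).Φ = delayFlow K ε := rfl

/-- Rescaled cycle time of the certified gate: `2`. [cite: Tao2016AveragedNS, Theorem 5.3] -/
@[simp] theorem τc_eq : (taoGate h).τc = 2 := rfl

/-- Admissible defect of the certified gate: `εd`. [folklore] -/
@[simp] theorem ε_eq : (taoGate h).ε = εd := rfl

/-- Tube radius of the certified gate: `θ - ρe^{2L}`. [folklore] -/
@[simp] theorem δsh_eq : (taoGate h).δsh = θ - ρ * Real.exp (delayLipschitz K ε 2 * 2) := rfl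

/-- The designed datum (5.6) is a loaded-core input of the certified gate. [cite: Tao2016AveragedNS, §5.5 (5.6)] -/
theorem delayInit_mem_Acore : delayInit ∈ (taoGate h).Acore :=
  delayInit_mem_trigIn (half_pos h.ρ_pos).le h.ε_pos

/-- So is every admissible kicked datum. [cite: Tao2016AveragedNS, §5.5 (5.6)] -/
theorem kickInit_mem_Acore {κ : ℝ} (hκ0 : 0 ≤ κ) (hκ : κ ≤ kickTolerance K ε) :
    kickInit κ ∈ (taoGate h).Acore :=
  kickInit_mem_trigIn (half_pos h.ρ_pos).le hκ0 hκ

/-- The flow line of the designed datum is THE trajectory of Theorem 5.3. [cite: Tao2016AveragedNS, §5.5] -/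
theorem Φ_delayInit : (fun σ => (taoGate h).Φ σ delayInit) = delaySolution K ε :=
  delayFlow_delayInit K ε

end taoGate

/-- **Gate budgets exist** for every admissible `K, ε` and every loss `0 < θ ≤ 1/4`: take
`ρ = 2εd = shadowRadius K ε 2 2 θ / 2`. [cite: HairerNorsettWanner1993, Thm I.10.2] -/
theorem GateBudget.exists_of
    {K ε θ : ℝ} (hK : (8 : ℝ) ^ 111 * (Nat.factorial 111 : ℝ) + 2 * 20 ^ 42 * (Nat.factorial 42 : ℝ) + 16 ≤ K)
    (hε : 0 < ε) (hεle : ε ≤ Real.exp (-(10 * K ^ 10)) / K ^ 100) (hθ0 : 0 < θ) (hθ : θ ≤ 1 / 4) :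
    ∃ ρ εd : ℝ, 0 < ρ ∧ 0 < εd ∧ GateBudget K ε ρ εd θ := by
  have hS : 0 < shadowRadius K ε 2 2 θ := by unfold shadowRadius; positivity
  refine ⟨shadowRadius K ε 2 2 θ / 2, shadowRadius K ε 2 2 θ / 4, by positivity, by positivity,
    GateBudget.of_le_shadowRadius hK hε hεle (by positivity) (by positivity) hθ (le_of_eq ?_)⟩
  ring

/-! ## §6. The numbers: the input class is a THIN, LONG neighbourhood of the trigger segment -/

/-- Thickness: a gate budget forces `ρ ≤ shadowRadius K ε 2 2 θ = θ·exp(-2·delayLipschitz K ε 2)`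
(`≤ θ e^{-16/ε²}`, `shadowRadius_le`). [cite: HairerNorsettWanner1993, Thm I.10.2] -/
theorem GateBudget.ρ_le_shadowRadius {K ε ρ εd θ : ℝ} (h : GateBudget K ε ρ εd θ) :
    ρ ≤ shadowRadius K ε 2 2 θ := by
  have hb := h.ρ_mul_exp_le
  have hE := Real.exp_pos (delayLipschitz K ε 2 * 2)
  unfold shadowRadius
  rw [Real.exp_neg, ← div_eq_mul_inv]
  exact (le_div_iff₀ hE).2 hb

/-- Length versus thickness: `shadowRadius K ε 2 2 θ < kickTolerance K ε` for `θ ≤ 1`,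
`0 < ε ≤ 1`, `K ≥ 1` — indeed `2·delayLipschitz K ε 2 ≥ 16K¹⁰ + 16/ε²` while
`kickTolerance = ε²e^{-K¹⁰+K⁹√K/4} ≥ e^{-K¹⁰ - 2/ε²}·…`; so the certified input class extends
along the trigger axis MUCH further (`seed·e^{K^{9.5}/4}`) than it is thick (`θe^{-O(K¹⁰/ε²)}`).
[cite: Tao2016AveragedNS, §5.5 proof of Theorem 5.3] -/
theorem shadowRadius_lt_kickTolerance {K ε θ : ℝ} (hK : 1 ≤ K) (hε : 0 < ε) (hε1 : ε ≤ 1)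
    (hθ : θ ≤ 1) : shadowRadius K ε 2 2 θ < kickTolerance K ε := by
  have hK0 : 0 ≤ K := by linarith
  have hK10 : 1 ≤ K ^ 10 := one_le_pow₀ hK
  -- lower bound for the exponent `2L ≥ 16 K¹⁰ + 16/ε²`
  have hL : 16 * K ^ 10 + 16 / ε ^ 2 ≤ delayLipschitz K ε 2 * 2 := by
    rw [coe_delayLipschitz hK0 hε]
    push_cast
    have h1 : K ^ 10 ≤ ε⁻¹ * K ^ 10 := by
      have : 1 ≤ ε⁻¹ := one_le_inv_iff₀.2 ⟨hε, hε1⟩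
      nlinarith
    have h2 : 0 ≤ ε + ε ^ 2 * Real.exp (-K ^ 10) + K := by positivity
    have h3 : 16 / ε ^ 2 = 16 * (ε ^ 2)⁻¹ := by ring
    rw [h3]
    nlinarith [inv_nonneg.2 (sq_nonneg ε)]
  -- `e^{-16/ε²} < ε²`
  have hεsq : 0 < ε ^ 2 := by positivity
  have hlog : -(16 / ε ^ 2) < Real.log (ε ^ 2) := by
    have hl : Real.log (ε ^ 2)⁻¹ ≤ (ε ^ 2)⁻¹ - 1 := Real.log_le_sub_one_of_pos (inv_pos.2 hεsq)
    rw [Real.log_inv] at hl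
    have : (ε ^ 2)⁻¹ - 1 < 16 / ε ^ 2 := by
      rw [div_eq_mul_inv]; nlinarith [inv_pos.2 hεsq]
    linarith
  have hkey : Real.exp (-(16 / ε ^ 2)) < ε ^ 2 := by
    calc Real.exp (-(16 / ε ^ 2)) < Real.exp (Real.log (ε ^ 2)) := Real.exp_lt_exp.2 hlog
      _ = ε ^ 2 := Real.exp_log hεsq
  have hθ' : shadowRadius K ε 2 2 θ ≤ Real.exp (-(delayLipschitz K ε 2 * 2)) := by
    unfold shadowRadius
    exact (mul_le_of_le_one_left (Real.exp_pos _).le hθ)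
  have hsplit : Real.exp (-(delayLipschitz K ε 2 * 2)) ≤
      Real.exp (-(16 / ε ^ 2)) * Real.exp (-K ^ 10 + K ^ 9 * Real.sqrt K / 4) := by
    rw [← Real.exp_add]
    refine Real.exp_le_exp.2 ?_
    have : 0 ≤ K ^ 9 * Real.sqrt K / 4 := by positivity
    nlinarith
  calc shadowRadius K ε 2 2 θ ≤ Real.exp (-(delayLipschitz K ε 2 * 2)) := hθ'
    _ ≤ Real.exp (-(16 / ε ^ 2)) * Real.exp (-K ^ 10 + K ^ 9 * Real.sqrt K / 4) := hsplit
    _ < ε ^ 2 * Real.exp (-K ^ 10 + K ^ 9 * Real.sqrt K / 4) :=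
        mul_lt_mul_of_pos_right hkey (Real.exp_pos _)
    _ = kickTolerance K ε := rfl

/-- Hence under a gate budget the input class is longer along the trigger axis than it is thick:
`ρ < kickTolerance K ε`. [cite: Tao2016AveragedNS, §5.5 proof of Theorem 5.3] -/
theorem GateBudget.ρ_lt_kickTolerance {K ε ρ εd θ : ℝ} (h : GateBudget K ε ρ εd θ) :
    ρ < kickTolerance K ε :=
  h.ρ_le_shadowRadius.trans_lt
    (shadowRadius_lt_kickTolerance h.one_le h.ε_pos h.ε_le_one (h.θ_le.trans (by norm_num)))


end Literature.Analysis.FluidPDE.Tao2016AveragedNS
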